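import Mathlib
import Summits.ResolutionOfSingularities.ResolutionOfSingularities.Theorems.WeightedInvariantLocalWeightedDropNCResCurveGraphIdeal
import Summits.ResolutionOfSingularities.ResolutionOfSingularities.Theorems.WeightedInvariantLocalWeightedDropTOT2BridgeDecorated

/-!
# `WeightedInvariant.LocalWeightedDrop`: NC-RESOLUTION SETTINGS for the TOT₂ line (S-SET) — GRAPH CURVES: the entry
# «a permissible smooth formal curve through the point is a GRAPH over one of the letters» (the LC bridge)

Crux item stmt-ResolutionOfSingularities-8899 `LocalWeightedDrop` (route `ResolutionOfSingularities/WeightedInvariant`), ENGINE skeleton v32,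
residual `stub_spaceNCRankDrop`; TOT2-LINE (res-L1-w43-lead-1) inner dispatch, sub-regime S-E1-CURVE of res-L1-w43-stub-1 (gap note
`L/res-L1-w43-stub-1/E1-CURVE-GAP.md`) × LINE `directrix-cut` v3 piece `ApexLineCurveExit` (res-L1-w43-strat-1, typed target
`L/res-L1-w43-strat-1/g8/lc_bridge_v1.lean`).  [OURS · L1 W4.3 · chain w43 · seat res-type-056; def-free on `GraphCurve` (parts 14–15); the
count game is the programme's own; nothing here is a statement of any manuscript; AI-produced, gate-checked, weaker than expert review.]

WHAT.  The hypothesis that leaves the isolated regime of `TOT2E1.dWinsTo_headDrop_of_isolated` is «there is a LEGAL coordinate change `Φ`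
(zero constant terms, invertible linear part) with `Φ^* g ∈ (x_0,…,x_{m-1})^c`», i.e. the germ `g` of order `c` is equimultiple along the
smooth formal curve `C = Φ̂(x_m-axis)`.  The S-E1-CURVE loop runs on GRAPH presentations `C = {x_j = φ_j(x_i)}`.  THE BRIDGE
(`exists_graph_of_legal_inAxisIdeal`): such a `Φ` yields a letter `i` and one-variable series `φ_j` (`φ_j(0) = 0`, `φ_i = T`) with
`GraphCurve.InOffIdeal i c (shear_i(φ)^* g)`.  PROOF (substitution algebra, no implicit function theorem): `γ_l(T) := Φ_l(T e_m)` parametrises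
`C`; `γ′(0)` is the `m`-th column of the linear part, non-zero (`det ≠ 0`), so some `γ_i` has `γ_i′(0) ≠ 0` and a compositional inverse `σ`
(`PowerSeries.substInvOfIsUnit`); `φ_l := γ_l ∘ σ`.  With `Ψ` the two-sided legal inverse of `Φ` (`exists_legal_inverse`) and `S := shear_i(φ)`:
`S^* g = Λ^* (Φ^* g)` for `Λ_j := S^* Ψ_j`, and for `j ≠ m` the restriction of `Λ_j` to the `i`-axis is `Ψ_j(φ(T)) = Ψ_j(Φ(σ(T) e_m)) =
(σ(T) e_m)_j = 0`, i.e. `InOffIdeal i 1 (Λ_j)` (axis restriction reads the pure powers: `coeff_subst_axisEmb`); stub-1's transport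
`GraphCurve.InOffIdeal.subst` then carries `InOffIdeal m c (Φ^* g)` (= `InAxisIdeal`, `inOffIdeal_last_iff_inAxisIdeal`) to `InOffIdeal i c (S^* g)`.
-/

set_option linter.dupNamespace false -- mandated namespace of this single-conjunct summit

noncomputable section

namespace Summit.ResolutionOfSingularities.ResolutionOfSingularities.Theorems

namespace TameFourTupleDrop

namespace GraphCurve

open MvPowerSeries Literature.AlgebraicGeometry.Resolution

variable {k : Type} [Field k] {m : ℕ}

/-! ## Restriction to a coordinate axis -/

/-- The axis embedding `x_i ↦ T`, `x_l ↦ 0` (`l ≠ i`) has zero constant terms. -/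
theorem constantCoeff_axisEmb (i l : Fin (m + 1)) :
    MvPowerSeries.constantCoeff ((fun l : Fin (m + 1) => if l = i then (PowerSeries.X : PowerSeries k) else 0) l) = 0 := by
  dsimp only
  split_ifs
  · exact PowerSeries.constantCoeff_X
  · exact map_zero _

/-- The axis embedding may be substituted. -/
theorem hasSubst_axisEmb (i : Fin (m + 1)) :
    HasSubst (fun l : Fin (m + 1) => if l = i then (PowerSeries.X : PowerSeries k) else 0) :=
  hasSubst_of_constantCoeff_zero (constantCoeff_axisEmb i)

/-- **THE AXIS RESTRICTION READS THE PURE POWERS**: the `n`-th coefficient of `G(0,…,T,…,0)` (`T` at letter `i`) is the coefficient of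
`x_i^n` in `G`. -/
theorem coeff_subst_axisEmb (i : Fin (m + 1)) (G : MvPowerSeries (Fin (m + 1)) k) (n : ℕ) :
    PowerSeries.coeff n (subst (fun l : Fin (m + 1) => if l = i then (PowerSeries.X : PowerSeries k) else 0) G) =
      coeff (Finsupp.single i n) G := by
  classical
  show MvPowerSeries.coeff (Finsupp.single () n) _ = _
  rw [coeff_subst (hasSubst_axisEmb i)]
  have hprod : ∀ d : Fin (m + 1) →₀ ℕ, MvPowerSeries.coeff (Finsupp.single () n)
      (d.prod fun s e => ((fun l : Fin (m + 1) => if l = i then (PowerSeries.X : PowerSeries k) else 0) s) ^ e) =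
      if d = Finsupp.single i n then 1 else 0 := by
    intro d
    by_cases hd : d = Finsupp.single i (d i)
    · -- a pure power of `x_i`
      rw [hd, Finsupp.prod_single_index (by simp only [pow_zero])]
      simp only [if_true]
      rw [show MvPowerSeries.coeff (Finsupp.single () n) ((PowerSeries.X : PowerSeries k) ^ (d i)) =
        PowerSeries.coeff n ((PowerSeries.X : PowerSeries k) ^ (d i)) from rfl, PowerSeries.coeff_X_pow]
      by_cases hn : n = d i
      · rw [if_pos hn, if_pos (by rw [hn])]
      · rw [if_neg hn, if_neg (fun h => hn (Finsupp.single_injective i h).symm)]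
    · -- another letter occurs: the product vanishes
      have hs : ∃ s, s ≠ i ∧ d s ≠ 0 := by
        by_contra hne
        push Not at hne
        apply hd
        ext s
        by_cases hsi : s = i
        · rw [hsi, Finsupp.single_eq_same]
        · rw [Finsupp.single_apply, if_neg (Ne.symm hsi), hne s hsi]
      obtain ⟨s, hsi, hs0⟩ := hs
      rw [Finsupp.prod, ← Finset.mul_prod_erase _ _ (Finsupp.mem_support_iff.mpr hs0)]
      simp only [if_neg hsi, zero_pow hs0, zero_mul, map_zero]
      rw [if_neg]
      rintro rfl
      rw [Finsupp.single_apply, if_neg (Ne.symm hsi)] at hs0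
      exact hs0 rfl
  rw [finsum_eq_single _ (Finsupp.single i n) (fun d hd => by rw [hprod d, if_neg hd, smul_zero]), hprod, if_pos rfl, smul_eq_mul,
    mul_one]

/-- A germ whose restriction to the `i`-axis vanishes lies in the ideal of the other letters: `InOffIdeal i 1`. -/
theorem inOffIdeal_one_of_subst_axisEmb_eq_zero {i : Fin (m + 1)} {G : MvPowerSeries (Fin (m + 1)) k}
    (h : subst (fun l : Fin (m + 1) => if l = i then (PowerSeries.X : PowerSeries k) else 0) G = 0) : InOffIdeal i 1 G := by
  intro E hE
  by_contra hlt
  have h0 : offDeg i E = 0 := by omega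
  have hE' := eq_single_of_offDeg_eq_zero h0
  rw [hE', ← coeff_subst_axisEmb, h, map_zero] at hE
  exact hE rfl

/-! ## The curve parametrised along the last axis -/

/-- Some entry of each column of an invertible linear part is non-zero. -/
theorem exists_coeff_single_ne_zero_of_isUnit_det {Φ : Fin (m + 1) → MvPowerSeries (Fin (m + 1)) k}
    (hΦdet : IsUnit (Matrix.det (Matrix.of fun a j : Fin (m + 1) => coeff (Finsupp.single j 1) (Φ a)))) (j : Fin (m + 1)) :
    ∃ a, coeff (Finsupp.single j 1) (Φ a) ≠ 0 := by
  by_contra h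
  push Not at h
  exact hΦdet.ne_zero (Matrix.det_eq_zero_of_column_eq_zero j fun a => by rw [Matrix.of_apply]; exact h a)

/-! ## The bridge -/

/-- **THE LC BRIDGE, GRAPH FORM.**  A legal `Φ` (zero constant terms, invertible linear part) with `Φ^* g ∈ (x_0,…,x_{m-1})^c`
(`AxisPolyhedron.InAxisIdeal c`) yields a letter `i` and a graph datum `φ` (`φ_j(0) = 0`, `φ_i = T`) such that the `i`-axis is permissible at
order `c` for `shear_i(φ)^* g` (`GraphCurve.InOffIdeal i c`): the curve `Φ̂(x_m-axis)` is the graph `{x_j = φ_j(x_i)}`.  See the module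
docstring for the proof. -/
theorem exists_shear_inOffIdeal_of_legal_inAxisIdeal {Φ : Fin (m + 1) → MvPowerSeries (Fin (m + 1)) k}
    (hΦ0 : ∀ l, constantCoeff (Φ l) = 0)
    (hΦdet : IsUnit (Matrix.det (Matrix.of fun a j : Fin (m + 1) => coeff (Finsupp.single j 1) (Φ a))))
    {c : ℕ} {g : MvPowerSeries (Fin (m + 1)) k} (hin : AxisPolyhedron.InAxisIdeal c (subst Φ g)) :
    ∃ (i : Fin (m + 1)) (φ : Fin (m + 1) → PowerSeries k), (∀ j, PowerSeries.constantCoeff (φ j) = 0) ∧ φ i = PowerSeries.X ∧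
      InOffIdeal i c (subst (shear i φ) g) := by
  classical
  have hΦs : HasSubst Φ := hasSubst_of_constantCoeff_zero hΦ0
  -- the two-sided legal inverse
  obtain ⟨Ψ, hΨ0, -, hΨΦ, hΦΨ, -⟩ := exists_legal_inverse hΦ0 hΦdet
  have hΨs : HasSubst Ψ := hasSubst_of_constantCoeff_zero hΨ0
  -- the curve parametrised along the last axis: `γ_l(T) = Φ_l(T e_m)`
  set A : Fin (m + 1) → PowerSeries k := fun l => if l = Fin.last m then (PowerSeries.X : PowerSeries k) else 0 with hA
  have hAs : HasSubst A := hasSubst_axisEmb (Fin.last m)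
  set γ : Fin (m + 1) → PowerSeries k := fun l => subst A (Φ l) with hγ
  have hγcoeff : ∀ l n, PowerSeries.coeff n (γ l) = coeff (Finsupp.single (Fin.last m) n) (Φ l) := fun l n =>
    coeff_subst_axisEmb (Fin.last m) (Φ l) n
  have hγ0 : ∀ l, PowerSeries.constantCoeff (γ l) = 0 := fun l => by
    rw [← PowerSeries.coeff_zero_eq_constantCoeff_apply, hγcoeff, Finsupp.single_zero, MvPowerSeries.coeff_zero_eq_constantCoeff_apply,
      hΦ0]
  -- a component with non-zero linear term, and its compositional inverse
  obtain ⟨i, hi⟩ := exists_coeff_single_ne_zero_of_isUnit_det hΦdet (Fin.last m)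
  have hγi1 : IsUnit (PowerSeries.coeff 1 (γ i)) := by rw [hγcoeff]; exact (Ne.isUnit hi)
  set σ : PowerSeries k := PowerSeries.substInvOfIsUnit (γ i) hγi1 with hσ
  have hσs : PowerSeries.HasSubst σ := PowerSeries.HasSubst.substInvOfIsUnit (γ i) hγi1
  have hσ0 : PowerSeries.constantCoeff σ = 0 := PowerSeries.constantCoeff_substInvOfIsUnit (γ i) hγi1
  have hγσ : PowerSeries.subst σ (γ i) = PowerSeries.X := PowerSeries.subst_substInvOfIsUnit_right (γ i) (hγ0 i) hγi1
  -- the graph datum `φ_l := γ_l ∘ σ`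
  set φ : Fin (m + 1) → PowerSeries k := fun l => PowerSeries.subst σ (γ l) with hφ
  have hφ0 : ∀ j, PowerSeries.constantCoeff (φ j) = 0 := fun j =>
    PowerSeries.constantCoeff_subst_eq_zero hσ0 (γ j) (hγ0 j)
  have hφi : φ i = PowerSeries.X := hγσ
  -- `φ_l = Φ_l(σ(T) e_m)`
  set B : Fin (m + 1) → PowerSeries k := fun l => if l = Fin.last m then σ else 0 with hB
  have hB0 : ∀ l, MvPowerSeries.constantCoeff (B l) = 0 := fun l => by
    simp only [hB]
    split_ifs
    · exact hσ0
    · exact map_zero _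
  have hBs : HasSubst B := hasSubst_of_constantCoeff_zero hB0
  have hAB : ∀ l, PowerSeries.subst σ (A l) = B l := fun l => by
    simp only [hA, hB]
    split_ifs
    · exact PowerSeries.subst_X hσs
    · rw [← PowerSeries.coe_substAlgHom hσs, map_zero]
  have hφB : ∀ l, φ l = subst B (Φ l) := fun l => by
    simp only [hφ, hγ]
    rw [PowerSeries.subst_def, subst_comp_subst_apply hAs (PowerSeries.HasSubst.const hσs),
      show (fun s => subst (fun _ : Unit => σ) (A s)) = B from funext fun s => by rw [← PowerSeries.subst_def]; exact hAB s]
  -- the graph shear and the transported family `Λ_j := S^* Ψ_j`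
  have hSs : HasSubst (shear i φ) := hasSubst_shear fun j _ => hφ0 j
  set Λ : Fin (m + 1) → MvPowerSeries (Fin (m + 1)) k := fun j => subst (shear i φ) (Ψ j) with hΛ
  have hΛ0 : ∀ j, constantCoeff (Λ j) = 0 := fun j =>
    constantCoeff_subst_eq_zero hSs (constantCoeff_shear fun j _ => hφ0 j) (hΨ0 j)
  have hΛs : HasSubst Λ := hasSubst_of_constantCoeff_zero hΛ0
  have hSg : subst (shear i φ) g = subst Λ (subst Φ g) := by
    conv_lhs => rw [← hΨΦ g]
    rw [subst_comp_subst_apply hΨs hSs]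
  -- the restriction of `Λ_j` to the `i`-axis is `Ψ_j(Φ(σ(T) e_m)) = (σ(T) e_m)_j`
  set Ai : Fin (m + 1) → PowerSeries k := fun l => if l = i then (PowerSeries.X : PowerSeries k) else 0 with hAi
  have hAis : HasSubst Ai := hasSubst_axisEmb i
  have hAiS : ∀ l, subst Ai (shear i φ l) = φ l := fun l => by
    by_cases hl : l = i
    · rw [hl, shear_self, subst_X hAis, hφi]
      simp only [hAi, if_true]
    · rw [shear_of_ne hl, subst_add hAis, subst_X hAis, onLetter, PowerSeries.subst_def,
        subst_comp_subst_apply (hasSubst_of_constantCoeff_zero fun _ => constantCoeff_X i) hAis]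
      simp only [subst_X hAis]
      simp only [hAi, if_neg hl, if_true, zero_add]
      rw [← PowerSeries.subst_def]
      exact PowerSeries.X_subst (φ l)
  have hAiΛ : ∀ j, subst Ai (Λ j) = B j := fun j => by
    simp only [hΛ]
    rw [subst_comp_subst_apply hSs hAis, show (fun l => subst Ai (shear i φ l)) = fun l => subst B (Φ l) from
      funext fun l => (hAiS l).trans (hφB l), ← subst_comp_subst_apply hΦs hBs, ← subst_X (R := k) hΨs j, hΦΨ, subst_X hBs]
  have hoff : ∀ j, j ≠ Fin.last m → InOffIdeal i 1 (Λ j) := fun j hj =>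
    inOffIdeal_one_of_subst_axisEmb_eq_zero (by rw [hAiΛ j]; simp only [hB, if_neg hj])
  -- transport the permissibility
  refine ⟨i, φ, hφ0, hφi, ?_⟩
  rw [hSg]
  exact ((inOffIdeal_last_iff_inAxisIdeal c _).mpr hin).subst Λ hΛs hoff

end GraphCurve

open MvPowerSeries Literature.AlgebraicGeometry.Resolution in
/-- **THE LC BRIDGE** (res-L1-w43-strat-1's target `exists_graph_of_legal_inAxisIdeal`, `L/res-L1-w43-strat-1/g8/lc_bridge_v1.lean`,
signature verbatim): a legal `Φ` with `Φ^* g ∈ (x_0,…,x_{m-1})^c` yields a graph presentation `x_j = φ_j(x_i)` of the curve along which `g`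
has order `c` — `GraphCurve.exists_shear_inOffIdeal_of_legal_inAxisIdeal` with `GraphCurve.shear`, `GraphCurve.InOffIdeal`,
`GraphCurve.offDeg` unfolded. -/
theorem exists_graph_of_legal_inAxisIdeal {k : Type} [Field k] {m : ℕ} {Φ : Fin (m + 1) → MvPowerSeries (Fin (m + 1)) k}
    (hΦ0 : ∀ l, constantCoeff (Φ l) = 0)
    (hΦdet : IsUnit (Matrix.det (Matrix.of fun a j : Fin (m + 1) => coeff (Finsupp.single j 1) (Φ a))))
    {c : ℕ} {g : MvPowerSeries (Fin (m + 1)) k} (hin : AxisPolyhedron.InAxisIdeal c (subst Φ g)) :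
    ∃ (i : Fin (m + 1)) (φ : Fin (m + 1) → PowerSeries k), (∀ j, PowerSeries.constantCoeff (φ j) = 0) ∧
      ∀ E : Fin (m + 1) →₀ ℕ,
        coeff E (subst (fun j => if j = i then X i else X j + PowerSeries.subst (X i : MvPowerSeries (Fin (m + 1)) k) (φ j)) g) ≠ 0 →
          c ≤ ∑ j ∈ Finset.univ.erase i, E j := by
  obtain ⟨i, φ, hφ0, -, hoff⟩ := GraphCurve.exists_shear_inOffIdeal_of_legal_inAxisIdeal hΦ0 hΦdet hin
  exact ⟨i, φ, hφ0, hoff⟩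

open MvPowerSeries Literature.AlgebraicGeometry.Resolution in
/-- CONSEQUENCE FOR THE LINE `directrix-cut`: the «∃ legal Φ» hypothesis of `ApexLineCurveExit` (v3 module §5, verbatim shape) in graph form
(res-L1-w43-strat-1's `exists_graph_of_apexLineCurve_hyp`, signature verbatim). -/
theorem exists_graph_of_apexLineCurve_hyp {k : Type} [Field k] {m : ℕ} {f : MvPowerSeries (Fin (m + 1)) k} {O : Finset (Fin (m + 1))}
    {c : ℕ}
    (h : ∃ Φ : Fin (m + 1) → MvPowerSeries (Fin (m + 1)) k, (∀ l, constantCoeff (Φ l) = 0) ∧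
      IsUnit (Matrix.det (Matrix.of fun a j : Fin (m + 1) => coeff (Finsupp.single j 1) (Φ a))) ∧
      AxisPolyhedron.InAxisIdeal c (subst Φ (f * ∏ l ∈ O, X l))) :
    ∃ (i : Fin (m + 1)) (φ : Fin (m + 1) → PowerSeries k), (∀ j, PowerSeries.constantCoeff (φ j) = 0) ∧
      ∀ E : Fin (m + 1) →₀ ℕ,
        coeff E (subst (fun j => if j = i then X i else X j + PowerSeries.subst (X i : MvPowerSeries (Fin (m + 1)) k) (φ j))
          (f * ∏ l ∈ O, X l)) ≠ 0 → c ≤ ∑ j ∈ Finset.univ.erase i, E j := by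
  obtain ⟨Φ, hΦ0, hΦdet, hin⟩ := h
  exact exists_graph_of_legal_inAxisIdeal hΦ0 hΦdet hin

end TameFourTupleDrop

end Summit.ResolutionOfSingularities.ResolutionOfSingularities.Theorems

end
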